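import Mathlib
import Summits.AtomisticToContinuum.HydrodynamicLimit.Theorems.InformationPercolationEngineKickFairRelEquilibriumMesoKineticWindowCutDefs
import Literature.MathematicalPhysics.KineticTheory.CollisionWindowCompensator
import HarnessLib

/-!
# Vocabulary of the line `kinetic-window-cut`, rev 5 (the LONG-FLIGHT window cut), for the crux `KickFairRelEquilibriumMeso`
(stmt-AtomisticToContinuum-15177; rank 2 of route `InformationPercolationEngine`) — lead c8

Definitions-only support file (`--supports stmt-AtomisticToContinuum-15177`) of the lead prover (c8) of the registered line
`Cruxes/KickFairRelEquilibriumMeso/Lines/kinetic_window_cut.lean`. It extends the line vocabularies `…KineticWindowCutDefs` (strategist s1 / lead c7: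
`SameWindow`, `PairClose`, `PairFar`, SW, CP) and `…ConditionThePastDefs` (`kickDev`, `betaLG`, `pairCondCovLG`, `SingleKickBias`, …) by the objects
of the lead's RESHAPE (rev 5), which imports the landed short-flight cut of the dead line `Sketch` into the kinetic-window cut:

* the crux's weights `h` are split `h = h·1_L + h·1_S` by the length of the flight of sphere `i` ending in the kick (`IsLong A tw p :
  tw / A ≤ t − s_i`, read off the typed past); the SHORT part is the registered statement U of the line `Sketch` (`ShortFlightLG`, named here;
  proved at constant profiles, `shortFlightLG_rung0` p126384); on the LONG part every sphere has at most `A + 1` kicks per kinetic window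
  PATHWISE (`stub_cutCount` p121309), so the same-window pair count is deterministically `O((A+1)²(N+1)² W)` — the second-moment
  (pair-Campbell) count input of rev 3's SW/CP (c7 wave 4: `WindowCountSqMomentConst`) is not needed, and neither is the index truncation /
  CT-a (Fatou in the truncation level);
* closeness of two same-window kicks is read at a COMMON GRID TIME through the two typed pasts: the predicted collision point `predPt` of
  the first kick (centre of the first-photo cell of sphere `i` moved by its free flight `(t − s_i) v_i`; within `r` of the true collision
  point) against the ANCHOR `anchorPt` of the second kick's sphere `i'` (centre of its first-photo cell moved by `(u(t') − s_{i'}) v_{i'}`,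
  `u(t') = m (⌈t'/m⌉ − 1)`, `m = tw/(2A)`, a grid time in `(s_{i'}, t')` for long kicks; within `r` of the true position of `i'` at time
  `u(t')`); a pair is CLOSE (`PairCloseL`) if same window and (the two points are within `5r` OR `i'` is fast on its last flight,
  `‖v_{i'}‖ > rA/tw`), FAR (`PairFarL`) otherwise — far pairs have collision points `≥ 2r` apart (mesoscopic separation), close pairs are
  counted by torus packing at the `≤ 2A + 2` grid times of a window plus the energy bound on fast spheres (CPL, provable for all profiles).

The statements: `ShortFlightLG` (U, verbatim the registered signature of `stub_shortFlightLG` of `Lines/Sketch.lean`), `SameWindowPairCovLong`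
(SWL), `ClosePairCountLong` (CPL), `TruncatedFluctuationLong` (TFL, the intermediate statement of the glue: the index-truncated fluctuation over
weights supported on long flights, uniformly in the truncation level); and, for the equilibrium case, `SameWindowPairCovLongConst` (SWL at
constant profiles) with its pure-decorrelation input `FarPairDecorrelationLongConst`. Nothing is asserted: every `def … : Prop` is a predicate a stub proves or
the glue consumes. Proved here (registered sub-goal `measurableSet_pairCloseL`): the new pair event is Borel on `Past N × Past N`, and `IsLong`
is a Borel event of the past.
-/

noncomputable section

open MeasureTheory Set Filter Topology
open scoped ENNReal Classical

namespace Summit.AtomisticToContinuum.HydrodynamicLimit.Theorems.KickFairRelEquilibriumMesoLine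

open Literature.Analysis.FluidPDE Literature.MathematicalPhysics.KineticTheory

/-! ## Line objects (rev 5) -/

/-- **Long flight**: the free flight of sphere `i` ending in the kick, `t − s_i` (coordinates `.2.2.2 − .2.1` of the typed past), lasts at
least `tw / A` (used with `tw = tN N`). Complement of the short-flight flag of `ShortFlightLG`. -/
def IsLong {N : ℕ} (A tw : ℝ) (p : Past N) : Prop :=
  tw / A ≤ p.2.2.2 - p.2.1

/-- The grid mesh `m = tw / (2A)` of the common grid times. -/
def gridMesh (A tw : ℝ) : ℝ := tw / (2 * A)

/-- The grid index of a time `t`: `⌈t / m⌉ − 1`, so that the grid time `m · gridIdx` lies in `[t − m, t)`; two times `≥ 2m = tw/A` apart have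
distinct grid indices. -/
def gridIdx (A tw t : ℝ) : ℤ := ⌈t / gridMesh A tw⌉ - 1

/-- The grid time `u(t) = m (⌈t/m⌉ − 1) ∈ [t − m, t)` preceding `t`. -/
def gridTime (A tw t : ℝ) : ℝ := gridMesh A tw * (gridIdx A tw t : ℝ)

/-- **Predicted collision point** of sphere `i` read off its typed past `p`: the centre of its first-photo cell (cell of `x_i(s_i)`, mesh `r`)
translated by the free flight `(t − s_i) · v_i` (exact velocity of the first photo). On the good set it is within `r` of the true collision
point `x_i(t)` (sphere `i` flies freely on `[s_i, t]`). -/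
def predPt {N : ℕ} (r : ℝ) (p : Past N) (i : Fin (N + 1)) : T3 :=
  cellCentre r (p.1.1.1 i).1 + Literature.Analysis.FunctionSpaces.Torus.proj ((p.2.2.2 - p.2.1) • (p.1.1.1 i).2)

/-- **Anchor** of sphere `i` read off its typed past `p`: the centre of its first-photo cell translated by `(u(t) − s_i) · v_i`, `u(t)` the grid
time preceding the collision time. For a long kick `u(t) ∈ (s_i, t)`, so on the good set the anchor is within `r` of the true position of `i`
at the grid time `u(t)`, where its velocity is the photo velocity `v_i`. -/
def anchorPt {N : ℕ} (r A tw : ℝ) (p : Past N) (i : Fin (N + 1)) : T3 :=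
  cellCentre r (p.1.1.1 i).1 + Literature.Analysis.FunctionSpaces.Torus.proj ((gridTime A tw p.2.2.2 - p.2.1) • (p.1.1.1 i).2)

/-- **Near-or-fast test** of the ordered pair (kick of `i` with past `p`, kick of `i'` with past `p'`): the predicted collision point of the
first is within `5r` of the anchor of the second's sphere, or that sphere is fast on its last flight (`‖v_{i'}‖ > r A / tw`, i.e. it may
travel more than `r/2` in one grid step). -/
def NearOrFast {N : ℕ} (r A tw : ℝ) (p p' : Past N) (i i' : Fin (N + 1)) : Prop :=
  Torus.euclidDist (predPt r p i) (anchorPt r A tw p' i') ≤ 5 * r ∨ r * A / tw < ‖(p'.1.1.1 i').2‖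

/-- **Close pair (rev 5)**: same kinetic window, and near-or-fast. Counted by CPL. -/
def PairCloseL {N : ℕ} (r A tw : ℝ) (p p' : Past N) (i i' : Fin (N + 1)) : Prop :=
  SameWindow tw p p' ∧ NearOrFast r A tw p p' i i'

/-- **Far pair (rev 5)**: same kinetic window, neither near nor fast — on the good set, for long kicks, the two collision points are at
torus distance `≥ 5r − r − r − r = 2r` (mesoscopic separation). Charged `|Γ|` by SWL. -/
def PairFarL {N : ℕ} (r A tw : ℝ) (p p' : Past N) (i i' : Fin (N + 1)) : Prop :=
  SameWindow tw p p' ∧ ¬ NearOrFast r A tw p p' i i'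

/-! ## The statements of rev 5 (predicates) -/

/-- **U — THE NORMALISED NUMBER OF SHORT-FLIGHT COLLISIONS IS SMALL IN `LG`-MEAN** (verbatim the registered signature of the stub
`stub_shortFlightLG` of the line `Sketch`, `Cruxes/KickFairRelEquilibriumMeso/Lines/Sketch.lean` rev 7–11; named here so that rev 5 can take it BY
NAME): for continuous positive profiles `∃ σ₀ ∀ σ < σ₀ ∀ Φ τ δ ∃ A > 0 ∃ N₀ ∀ N ≥ N₀`,
`E_{LG}[(ε/(N+1)) Σ_i #{n < cnt_i : t_{i,n} − s_i < t_N / A}] ≤ δ`. Proved at constant profiles (`shortFlightLG_rung0`, p126384: a first-moment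
collision-flux computation); implies CT-a (`countExcessLG_of_shortFlightLG`, p148642); `LG`-native off equilibrium (count class). -/
def ShortFlightLG : Prop :=
    ∀ (a₀ θ₀ : T3 → ℝ) (u₀ : T3 → V3), Continuous a₀ → Continuous θ₀ → Continuous u₀ →
    (∀ x, 0 < a₀ x) → (∀ x, 0 < θ₀ x) →
    ∃ σ₀ : ℝ, 0 < σ₀ ∧ ∀ σ : ℝ, 0 < σ → σ < σ₀ → ∀ Φ : (N : ℕ) → Flow σ N, ∀ τ : ℝ, 0 < τ →
    ∀ δ : ℝ, 0 < δ → ∃ A : ℝ, 0 < A ∧ ∃ N₀ : ℕ, ∀ N : ℕ, N₀ ≤ N →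
    ∫⁻ z, ENNReal.ofReal (hsDiameter σ N / ((N : ℝ) + 1) *
        ∑ i : Fin (N + 1), ∑ n ∈ Finset.range (cnt (Φ N) τ z i),
          (if (past (Φ N) (rs N) z i n).2.2.2 - (past (Φ N) (rs N) z i n).2.1 < tN N / A then (1 : ℝ) else 0))
        ∂(localGibbsLaw σ a₀ u₀ θ₀ N (Φ N)) ≤ ENNReal.ofReal δ

/-- **SWL — SAME-WINDOW FAR PAIRS OF LONG-FLIGHT KICKS: CONDITIONAL COVARIANCE (`N^{1/3}`-normalised pair-Campbell-`L¹`).** Along `rs`: for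
continuous positive profiles `∃ σ₀ ∀ σ < σ₀ ∀ Φ τ g ∀ A > 0 ∀ δ ∃ N₀ ∀ N ≥ N₀`,
`E_LG[(N+1)^{1/3} (ε/(N+1))² Σ_{(i,n)} Σ_{(i',n')} 1_{L}(P_{i,n}) 1_{L}(P_{i',n'}) 1_{PairFarL} |Γ((i,n),(i',n'))|] ≤ δ`, `Γ = pairCondCovLG`, `L` = flight
`≥ t_N/A`. The pair content of the line in its rev-5 cut: two kicks in the same kinetic window whose collision points are `≥ 2 rs N` apart, each
preceded by a flight `≥ t_N/A`, each centred at its own `LG`-conditional mean, are conditionally uncorrelated given the join of their typed pasts,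
on pair-average — with a DETERMINISTIC number of pairs (`≤ (A+1)²(N+1)² W`), so that at constant profiles SWL is a pure decorrelation statement. -/
def SameWindowPairCovLong (rs : ℕ → ℝ) : Prop :=
  ∀ (a₀ θ₀ : T3 → ℝ) (u₀ : T3 → V3), Continuous a₀ → Continuous θ₀ → Continuous u₀ →
    (∀ x, 0 < a₀ x) → (∀ x, 0 < θ₀ x) → ∃ σ₀ : ℝ, 0 < σ₀ ∧ ∀ σ : ℝ, 0 < σ → σ < σ₀ →
    ∀ Φ : (N : ℕ) → Flow σ N, ∀ τ : ℝ, 0 < τ →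
    ∀ g : V3 × V3 × V3 → ℝ, Continuous g → (∃ C : ℝ, ∀ p, |g p| ≤ C) →
    ∀ A : ℝ, 0 < A → ∀ δ : ℝ, 0 < δ → ∃ N₀ : ℕ, ∀ N : ℕ, N₀ ≤ N →
    ∫⁻ z, ENNReal.ofReal (((N : ℝ) + 1) ^ (1 / 3 : ℝ) * (hsDiameter σ N / ((N : ℝ) + 1)) ^ 2 *
        ∑ i : Fin (N + 1), ∑ n ∈ Finset.range (cnt (Φ N) τ z i),
          ∑ i' : Fin (N + 1), ∑ n' ∈ Finset.range (cnt (Φ N) τ z i'),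
            (if IsLong A (tN N) (past (Φ N) (rs N) z i n) ∧ IsLong A (tN N) (past (Φ N) (rs N) z i' n') ∧
                PairFarL (rs N) A (tN N) (past (Φ N) (rs N) z i n) (past (Φ N) (rs N) z i' n') i i'
              then (1 : ℝ) else 0) *
              |pairCondCovLG σ a₀ θ₀ u₀ (Φ N) (rs N) g i n i' n' z|)
        ∂(localGibbsLaw σ a₀ u₀ θ₀ N (Φ N)) ≤ ENNReal.ofReal δ

/-- **CPL — CLOSE SAME-WINDOW PAIRS OF LONG-FLIGHT KICKS: COUNT (`N^{1/3}`-normalised, `LG`-mean).** Along `rs`: for continuous positive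
profiles `∃ σ₀ ∀ σ < σ₀ ∀ Φ τ ∀ A > 0 ∀ δ ∃ N₀ ∀ N ≥ N₀`,
`E_LG[(N+1)^{1/3} (ε/(N+1))² #{((i,n),(i',n')) : both long, PairCloseL}] ≤ δ`. Deterministic on the energy-typical set (injection of long kicks into
(sphere, grid time), torus packing at `≤ 2A+2` grid times per window, energy bound on fast spheres), exponential `LG` energy tail off it. -/
def ClosePairCountLong (rs : ℕ → ℝ) : Prop :=
  ∀ (a₀ θ₀ : T3 → ℝ) (u₀ : T3 → V3), Continuous a₀ → Continuous θ₀ → Continuous u₀ →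
    (∀ x, 0 < a₀ x) → (∀ x, 0 < θ₀ x) → ∃ σ₀ : ℝ, 0 < σ₀ ∧ ∀ σ : ℝ, 0 < σ → σ < σ₀ →
    ∀ Φ : (N : ℕ) → Flow σ N, ∀ τ : ℝ, 0 < τ →
    ∀ A : ℝ, 0 < A → ∀ δ : ℝ, 0 < δ → ∃ N₀ : ℕ, ∀ N : ℕ, N₀ ≤ N →
    ∫⁻ z, ENNReal.ofReal (((N : ℝ) + 1) ^ (1 / 3 : ℝ) * (hsDiameter σ N / ((N : ℝ) + 1)) ^ 2 *
        ∑ i : Fin (N + 1), ∑ n ∈ Finset.range (cnt (Φ N) τ z i),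
          ∑ i' : Fin (N + 1), ∑ n' ∈ Finset.range (cnt (Φ N) τ z i'),
            (if IsLong A (tN N) (past (Φ N) (rs N) z i n) ∧ IsLong A (tN N) (past (Φ N) (rs N) z i' n') ∧
                PairCloseL (rs N) A (tN N) (past (Φ N) (rs N) z i n) (past (Φ N) (rs N) z i' n') i i'
              then (1 : ℝ) else 0))
        ∂(localGibbsLaw σ a₀ u₀ θ₀ N (Φ N)) ≤ ENNReal.ofReal δ

/-- **TFL — THE INDEX-TRUNCATED FLUCTUATION OVER LONG-FLIGHT WEIGHTS IS SMALL IN `L¹(LG)`, UNIFORMLY IN THE TRUNCATION LEVEL** (the intermediate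
statement of the rev-5 glue). Along `rs`: for continuous positive profiles `∃ σ₀ ∀ σ < σ₀ ∀ Φ τ g ∀ A > 0 ∀ δ ∃ N₀ ∀ N ≥ N₀ ∀ A' > 0 ∀ h` measurable,
`|h| ≤ 1`, VANISHING ON SHORT FLIGHTS (`¬ IsLong A (tN N) p → h i n p = 0`):
`E_{LG} |(ε/(N+1)) Σ_i Σ_{n<cnt_i} 1_{n < A'(N+1)^{1/3}} h_{i,n}(P_{i,n}) (D_{i,n} − β_{i,n})| ≤ δ`. The level `A'` is quantified AFTER `N₀` (every level
`⌈A'(N+1)^{1/3}⌉₊ ∈ ℕ` is reached), which is what the pathwise bound on long kicks buys; the reduction removes the truncation by Fatou. -/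
def TruncatedFluctuationLong (rs : ℕ → ℝ) : Prop :=
  ∀ (a₀ θ₀ : T3 → ℝ) (u₀ : T3 → V3), Continuous a₀ → Continuous θ₀ → Continuous u₀ →
    (∀ x, 0 < a₀ x) → (∀ x, 0 < θ₀ x) → ∃ σ₀ : ℝ, 0 < σ₀ ∧ ∀ σ : ℝ, 0 < σ → σ < σ₀ →
    ∀ Φ : (N : ℕ) → Flow σ N, ∀ τ : ℝ, 0 < τ →
    ∀ g : V3 × V3 × V3 → ℝ, Continuous g → (∃ C : ℝ, ∀ p, |g p| ≤ C) →
    ∀ A : ℝ, 0 < A → ∀ δ : ℝ, 0 < δ → ∃ N₀ : ℕ, ∀ N : ℕ, N₀ ≤ N → ∀ A' : ℝ, 0 < A' →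
    ∀ h : Fin (N + 1) → ℕ → Past N → ℝ, (∀ i n, Measurable (h i n)) → (∀ i n p, |h i n p| ≤ 1) →
    (∀ i n p, ¬ IsLong A (tN N) p → h i n p = 0) →
    ∫⁻ z, ENNReal.ofReal |hsDiameter σ N / ((N : ℝ) + 1) *
        ∑ i : Fin (N + 1), ∑ n ∈ Finset.range (cnt (Φ N) τ z i),
          (if (n : ℝ) < A' * ((N : ℝ) + 1) ^ (1 / 3 : ℝ) then (1 : ℝ) else 0) *
            (h i n (past (Φ N) (rs N) z i n) *
              (kickDev (Φ N) (rs N) g i n z - betaLG σ a₀ θ₀ u₀ (Φ N) (rs N) g i n z))|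
      ∂(localGibbsLaw σ a₀ u₀ θ₀ N (Φ N)) ≤ ENNReal.ofReal δ

/-! ## The equilibrium case of SWL: constant profiles, and its pure-decorrelation input -/

/-- **SWL at CONSTANT profiles** `(a, u, θ)` (the invariant canonical Gibbs law): SWL's body verbatim with `LG = G_{a,u,θ}`. The EQUILIBRIUM case
of the line's pair content; with B1_const (p156240), U_const (p126384), CPL and the rev-5 glue it is ALL that the equilibrium case of the crux needs. -/
def SameWindowPairCovLongConst (rs : ℕ → ℝ) : Prop :=
    ∀ (a θ : ℝ) (u : V3), 0 < a → 0 < θ → ∃ σ₀ : ℝ, 0 < σ₀ ∧ ∀ σ : ℝ, 0 < σ → σ < σ₀ →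
      ∀ Φ : (N : ℕ) → Flow σ N, ∀ τ : ℝ, 0 < τ →
      ∀ g : V3 × V3 × V3 → ℝ, Continuous g → (∃ C : ℝ, ∀ p, |g p| ≤ C) →
      ∀ A : ℝ, 0 < A → ∀ δ : ℝ, 0 < δ → ∃ N₀ : ℕ, ∀ N : ℕ, N₀ ≤ N →
      ∫⁻ z, ENNReal.ofReal (((N : ℝ) + 1) ^ (1 / 3 : ℝ) * (hsDiameter σ N / ((N : ℝ) + 1)) ^ 2 *
          ∑ i : Fin (N + 1), ∑ n ∈ Finset.range (cnt (Φ N) τ z i),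
            ∑ i' : Fin (N + 1), ∑ n' ∈ Finset.range (cnt (Φ N) τ z i'),
              (if IsLong A (tN N) (past (Φ N) (rs N) z i n) ∧ IsLong A (tN N) (past (Φ N) (rs N) z i' n') ∧
                  PairFarL (rs N) A (tN N) (past (Φ N) (rs N) z i n) (past (Φ N) (rs N) z i' n') i i'
                then (1 : ℝ) else 0) *
                |pairCondCovLG σ (fun _ => a) (fun _ => θ) (fun _ => u) (Φ N) (rs N) g i n i' n' z|)
          ∂(localGibbsLaw σ (fun _ => a) (fun _ => u) (fun _ => θ) N (Φ N)) ≤ ENNReal.ofReal δ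

/-- **Far-pair decorrelation of long-flight kicks at constant profiles, in pair-Campbell measure** (the PURE decorrelation input of
SWL_const: no count content, the number of long same-window pairs being deterministic): for every `η > 0`, eventually in `N`, the
`N^{1/3}`-normalised sum over far same-window pairs of long-flight kicks of the EXCESS `(|Γ| − η)₊` has mean `≤ η` under the invariant law. -/
def FarPairDecorrelationLongConst (rs : ℕ → ℝ) : Prop :=
    ∀ (a θ : ℝ) (u : V3), 0 < a → 0 < θ → ∃ σ₀ : ℝ, 0 < σ₀ ∧ ∀ σ : ℝ, 0 < σ → σ < σ₀ →
      ∀ Φ : (N : ℕ) → Flow σ N, ∀ τ : ℝ, 0 < τ →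
      ∀ g : V3 × V3 × V3 → ℝ, Continuous g → (∃ C : ℝ, ∀ p, |g p| ≤ C) →
      ∀ A : ℝ, 0 < A → ∀ η : ℝ, 0 < η → ∃ N₀ : ℕ, ∀ N : ℕ, N₀ ≤ N →
      ∫⁻ z, ENNReal.ofReal (((N : ℝ) + 1) ^ (1 / 3 : ℝ) * (hsDiameter σ N / ((N : ℝ) + 1)) ^ 2 *
          ∑ i : Fin (N + 1), ∑ n ∈ Finset.range (cnt (Φ N) τ z i),
            ∑ i' : Fin (N + 1), ∑ n' ∈ Finset.range (cnt (Φ N) τ z i'),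
              (if IsLong A (tN N) (past (Φ N) (rs N) z i n) ∧ IsLong A (tN N) (past (Φ N) (rs N) z i' n') ∧
                  PairFarL (rs N) A (tN N) (past (Φ N) (rs N) z i n) (past (Φ N) (rs N) z i' n') i i'
                then (1 : ℝ) else 0) *
                max (|pairCondCovLG σ (fun _ => a) (fun _ => θ) (fun _ => u) (Φ N) (rs N) g i n i' n' z| - η) 0)
          ∂(localGibbsLaw σ (fun _ => a) (fun _ => u) (fun _ => θ) N (Φ N)) ≤ ENNReal.ofReal η

/-! ## Borel plumbing of the new events -/

/-- **`IsLong` is a Borel event of the typed past** (a closed half-space in the two time coordinates). [folklore] -/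
theorem measurableSet_isLong : ∀ (N : ℕ) (A tw : ℝ), MeasurableSet {p : Past N | IsLong A tw p} := by
  intro N A tw
  have h1 : Measurable fun p : Past N => p.2.2.2 := measurable_snd.comp (measurable_snd.comp measurable_snd)
  have h2 : Measurable fun p : Past N => p.2.1 := measurable_fst.comp measurable_snd
  exact measurableSet_le measurable_const (h1.sub h2)

/-- The grid time is a Borel function of the time. [folklore] -/
theorem measurable_gridTime (A tw : ℝ) : Measurable (gridTime A tw) := by
  unfold gridTime gridIdx
  refine measurable_const.mul ?_
  have h : Measurable fun t : ℝ => ((⌈t / gridMesh A tw⌉ - 1 : ℤ) : ℝ) :=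
    (measurable_from_top (f := fun k : ℤ => ((k - 1 : ℤ) : ℝ))).comp (Int.measurable_ceil.comp (measurable_id.div_const _))
  exact h

/-- The predicted collision point is a Borel function of the typed past (for a fixed sphere). [folklore] -/
theorem measurable_predPt {N : ℕ} (r : ℝ) (i : Fin (N + 1)) : Measurable fun p : Past N => predPt r p i := by
  unfold predPt
  have hph : Measurable fun p : Past N => p.1.1.1 i :=
    (measurable_pi_apply i).comp (measurable_fst.comp (measurable_fst.comp measurable_fst))
  have hk : Measurable fun p : Past N => (p.1.1.1 i).1 := measurable_fst.comp hph
  have hv : Measurable fun p : Past N => (p.1.1.1 i).2 := measurable_snd.comp hph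
  have ht : Measurable fun p : Past N => p.2.2.2 - p.2.1 :=
    (measurable_snd.comp (measurable_snd.comp measurable_snd)).sub (measurable_fst.comp measurable_snd)
  have hc : Measurable fun p : Past N => cellCentre r (p.1.1.1 i).1 :=
    (measurable_of_countable (fun k : Fin 3 → ℤ => cellCentre r k)).comp hk
  exact hc.add (Literature.Analysis.FunctionSpaces.Torus.measurable_proj.comp (ht.smul hv))

/-- The anchor is a Borel function of the typed past (for a fixed sphere). [folklore] -/
theorem measurable_anchorPt {N : ℕ} (r A tw : ℝ) (i : Fin (N + 1)) : Measurable fun p : Past N => anchorPt r A tw p i := by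
  unfold anchorPt
  have hph : Measurable fun p : Past N => p.1.1.1 i :=
    (measurable_pi_apply i).comp (measurable_fst.comp (measurable_fst.comp measurable_fst))
  have hk : Measurable fun p : Past N => (p.1.1.1 i).1 := measurable_fst.comp hph
  have hv : Measurable fun p : Past N => (p.1.1.1 i).2 := measurable_snd.comp hph
  have ht : Measurable fun p : Past N => gridTime A tw p.2.2.2 - p.2.1 :=
    ((measurable_gridTime A tw).comp (measurable_snd.comp (measurable_snd.comp measurable_snd))).sub
      (measurable_fst.comp measurable_snd)
  have hc : Measurable fun p : Past N => cellCentre r (p.1.1.1 i).1 :=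
    (measurable_of_countable (fun k : Fin 3 → ℤ => cellCentre r k)).comp hk
  exact hc.add (Literature.Analysis.FunctionSpaces.Torus.measurable_proj.comp (ht.smul hv))

/-- **`NearOrFast` is a Borel event of the pair of typed pasts** (a closed condition on a continuous function of Borel maps, or an open
condition on a norm). [folklore] -/
theorem measurableSet_nearOrFast : ∀ (N : ℕ) (r A tw : ℝ) (i i' : Fin (N + 1)),
    MeasurableSet {q : Past N × Past N | NearOrFast r A tw q.1 q.2 i i'} := by
  intro N r A tw i i'
  have h1 : Measurable fun q : Past N × Past N => predPt r q.1 i := (measurable_predPt r i).comp measurable_fst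
  have h2 : Measurable fun q : Past N × Past N => anchorPt r A tw q.2 i' := (measurable_anchorPt r A tw i').comp measurable_snd
  have hd : Measurable fun q : Past N × Past N => Torus.euclidDist (predPt r q.1 i) (anchorPt r A tw q.2 i') := by
    simp_rw [Torus.euclidDist_eq]
    exact (Torus.measurable_reprSym.comp (h1.sub h2)).norm
  have hv : Measurable fun q : Past N × Past N => ‖(q.2.1.1.1 i').2‖ :=
    (measurable_snd.comp ((measurable_pi_apply i').comp
      (measurable_fst.comp (measurable_fst.comp (measurable_fst.comp measurable_snd))))).norm
  have hA : MeasurableSet {q : Past N × Past N | Torus.euclidDist (predPt r q.1 i) (anchorPt r A tw q.2 i') ≤ 5 * r} :=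
    measurableSet_le hd measurable_const
  have hB : MeasurableSet {q : Past N × Past N | r * A / tw < ‖(q.2.1.1.1 i').2‖} :=
    measurableSet_lt measurable_const hv
  have hU : {q : Past N × Past N | NearOrFast r A tw q.1 q.2 i i'} =
      {q : Past N × Past N | Torus.euclidDist (predPt r q.1 i) (anchorPt r A tw q.2 i') ≤ 5 * r} ∪
        {q : Past N × Past N | r * A / tw < ‖(q.2.1.1.1 i').2‖} := rfl
  rw [hU]
  exact hA.union hB

/-- **`PairCloseL` is a Borel event of the pair of typed pasts** (registered sub-goal `measurableSet_pairCloseL`: intersection of the Borel events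
`SameWindow` and `NearOrFast`). [folklore] -/
theorem measurableSet_pairCloseL : ∀ (N : ℕ) (r A tw : ℝ) (i i' : Fin (N + 1)),
    MeasurableSet {q : Past N × Past N | PairCloseL r A tw q.1 q.2 i i'} := by
  intro N r A tw i i'
  exact (measurableSet_sameWindow N tw).inter (measurableSet_nearOrFast N r A tw i i')

/-- **`PairFarL` is a Borel event of the pair of typed pasts.** [folklore] -/
theorem measurableSet_pairFarL : ∀ (N : ℕ) (r A tw : ℝ) (i i' : Fin (N + 1)),
    MeasurableSet {q : Past N × Past N | PairFarL r A tw q.1 q.2 i i'} := by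
  intro N r A tw i i'
  exact (measurableSet_sameWindow N tw).inter (measurableSet_nearOrFast N r A tw i i').compl

end Summit.AtomisticToContinuum.HydrodynamicLimit.Theorems.KickFairRelEquilibriumMesoLine

end
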